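import Literature.NumberTheory.Automorphic.ProjectiveDescentLatticeLevelsDischarge   -- ★ p843800 (this seat): (A)(B)(C) + dischargers (imports ★ p843787, ★ p843570)
import Literature.NumberTheory.Automorphic.SLTwoTreeProjectiveAction                 -- ★ B-p08 (g28) (W1c)-A: `glVertexAct`, `glVertexAct_eq_iff`
import Literature.NumberTheory.Automorphic.HermitianLatticeTreeApartment             -- ★ A-p17: `mapGL_latt_eq`
import Literature.NumberTheory.Automorphic.FixedCosetsStableLattices                 -- ★ B-p04: `span_range_transpose_eq_iff`
import Literature.NumberTheory.Automorphic.GLnAdelicStructure                        -- ★ `glDiagonal`, `coe_glDiagonal`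
import Literature.NumberTheory.Automorphic.CMLocalRankOneClassMapOpen                -- ★ `placeForm_antidiagTwo_eq`
import HarnessLib

/-!
# The two maximal compact levels of `U(1,1)(L_w)` at a non-split place as stabilisers in the tree of `SL₂(L⁺_v)`: `K = U ∩ GL₂(𝒪_w)`, `K♯ = U ∩ D GL₂(𝒪_w) D⁻¹`
(Tits (1979) §2.7, §3.9; Bruhat–Tits: at a RAMIFIED quadratic `L_w ∕ L⁺_v` the building of the quasi-split unitary group in two variables is the tree of
`SL₂(L⁺_v)`, its two conjugacy classes of maximal compact subgroups being the stabilisers of a vertex and of an edge (with inversion); Serre, *Trees* II.1.3)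

Topic `NumberTheory/Automorphic`; namespaces `Literature.NumberTheory.Automorphic.HermitianLatticeTree` (§1, generic) and `…Automorphic.UnitaryGroup` (§2, at a
place of a CM field).  KERNEL mathematics only: theorems, no definition, no named fact, no instance, no notation, no `sorry`.  Cell `pub/hodgecm-mathlib`,
F0∕P3a, crux H413 = `stmt-HodgeConjecture-24833`, line «N6nsGerm», residue «R2EP-wild» — ROAD W brick **(W2)** in `glVertexAct` currency (owner B-p10 (g26)
WORD W-1; (W1c)-B `rhoVertexAct` = B-p08 (g28); seat F0P3a-p04 (g14)).  HONEST LABEL: HC_CM is proved only modulo the printed citations until rung 0 closes;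
nothing printed is asserted here.

THE MATHEMATICS.  `F` a discretely valued field, `ϖ` a uniformiser, `X` the tree of `SL₂(F)` (★ `latticeTree (RingHom.id F) ϖ J`, vertices = special lattices),
`g · M := glVertexAct hϖ g M` the vertex action of `GL₂(F)` (★ B-p08, through `PGL₂(F)`), `v₀ = latt 1 = 𝒪²`, `v₁ = latt diag(1,ϖ) = 𝒪 ⊕ ϖ𝒪`, `D = diag(1,ϖ)`.
* §1 DICTIONARY `glVertexAct_eq_iff_exists_forall_v_le_one`: **`g · latt A = latt B ↔ ∃ k, B⁻¹ (ϖ^k g A) ∈ GL₂(𝒪)`** (★ `glVertexAct_eq_iff` read through ★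
  `span_range_transpose_eq_iff`), membership spelled «entries `v ≤ 1` and `v det = 1`» (`mem_glInt_iff_forall_v_le_one_and_v_det_eq_one`); the four lattice
  equations `g·v₀ = v₀`, `g·v₁ = v₁`, `g·v₀ = v₁`, `g·v₁ = v₀` (`glVertexAct_{root,next}_eq_{root,next}_iff`) and the edge condition `sym2_glVertexAct_eq_iff`:
  `s(g·v₀, g·v₁) = s(v₀, v₁) ↔` the right-hand side of ★ (B) `forall_v_conj_smul_map_le_one_iff_of_sq` VERBATIM.
* §2 AT A NON-SPLIT PLACE `w ∣ v` OF A CM FIELD `L` (`U_w = U(σ_w, (Φ₂)_w)`, ★ `placeForm_antidiagTwo_eq`; `ι = toPlace v w`; `α ∈ L_w` anti-fixed with `|α| ∈ {1, exp(−1)}`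
  — ★ `exists_units_galAdicCompletionMap_complexConj_eq_neg_of_ramified`; the descent `hsg : diag(1,α) u diag(1,α)⁻¹ = s · ι(g)` — ★ `exists_conj_diagonal_eq_smul_map_toPlace`;
  `η` ANY uniformiser unit of `L_w`, `D_η := glDiagonal ![1, η]`, `K♯ := D_η GL₂(𝒪_w) D_η⁻¹` as `(glInt 2 L_w).map (MulAut.conj D_η)` = ★ p843499's `K♯_D`):
  memberships by entries `coe_mem_glInt_iff_forall_v_le_one`, `coe_mem_map_conj_glDiagonal_iff_forall_v_le_one` (`|det u| = 1` ★ p843800), and THE FOUR HEADS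
  - `√u`-TYPE (`|α| = 1`; inert places, wild ramified of type `L⁺(√unit)`): **`u ∈ GL₂(𝒪_w) ↔ g·v₀ = v₀`** (`coe_mem_glInt_iff_glVertexAct_root_eq_of_v_eq_one`, ANY
    non-split `w`) and, at ramified `w`, **`u ∈ K♯ ↔ s(g·v₀, g·v₁) = s(v₀, v₁)`** (`coe_mem_map_conj_glDiagonal_iff_sym2_glVertexAct_eq_of_v_eq_one`);
  - `√π`-TYPE (`|α| = exp(−1)`; every tame place ★ `RamifiedPlaceAntiFixedUniformizer`, wild of type `L⁺(√π)`), ramified `w`: **`u ∈ K♯ ↔ g·v₁ = v₁`**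
    (`coe_mem_map_conj_glDiagonal_iff_glVertexAct_next_eq_of_v_eq_exp_neg_one`) and **`u ∈ GL₂(𝒪_w) ↔ s(g·v₁, g·v₀) = s(v₁, v₀)`**
    (`coe_mem_glInt_iff_sym2_glVertexAct_eq_of_v_eq_exp_neg_one`)
  = the `hKv`∕`hKe` binders of ★ p843743 `epEllipticRelation_vertexEdgeLevels_of_vertexAction_local'` (triple `(D_η, v₀, v₁)`) resp. `_local` (triple `(D_η, v₁, v₀)`)
  with `act u := glVertexAct hϖ (g u)`; B-p08's `rhoVertexAct u` IS `glVertexAct hϖ (g u)` for his fixed descent datum, so the `rhoVertexAct`-keyed corollaries are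
  one `rw` each (ED. 2 of this file, append-only, when (W1c)-B is ★).  Proofs: ★ p843787 (A) ∕ (A@Λ₁) ∕ (B) (`π := α·η`, resp. `v(αη) = v(ι ϖ)`), ★ p843800 §1–§4.
NOT here: the action's orbit statements (S3) (`hV`, `hD`: (W1c)-B), the torus step `hstep` ((W6-N), A-p06), the fold (B-p10).

## References
* [Tits1979] J. Tits, *Reductive groups over local fields*, PSPM 33.1 (1979), §2.7, §3.9.
* [Serre1980Trees] J.-P. Serre, *Trees* (1980), Ch. II §1.1–§1.3.
* [Kottwitz1988] R. E. Kottwitz, *Tamagawa numbers*, Ann. of Math. 127 (1988), §2.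
* [Rogawski1990] J. D. Rogawski, *Automorphic Representations of Unitary Groups in Three Variables* (1990), §3.6 p. 31.
* [Serre1979] J.-P. Serre, *Local Fields* (1979), Ch. II §1.
-/

set_option autoImplicit false

noncomputable section

open scoped WithZero ValuativeRel Matrix MatrixGroups
open Matrix WithZero ValuativeRel NumberField IsDedekindDomain

namespace Literature.NumberTheory.Automorphic.HermitianLatticeTree

open Literature.NumberTheory.Automorphic

/-! ## §1 The vertex action in `GL₂(𝒪)`-membership currency: `g · latt A = latt B ↔ ∃ k, B⁻¹ (ϖ^k g A) ∈ GL₂(𝒪)` -/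

section Dictionary

variable {F : Type*} [Field F] [Valued F ℤᵐ⁰] [ValuativeRel F] [(Valued.v : Valuation F ℤᵐ⁰).Compatible] {ϖ : F}
  (hϖ : IsUniformizingElement ϖ)

/-- `GL_n(𝒪)` by entries and determinant: `h ∈ glInt ↔` all entries `v ≤ 1` and `v(det h) = 1`. [cite: Serre1979, Ch. II §1] -/
theorem mem_glInt_iff_forall_v_le_one_and_v_det_eq_one {n : ℕ} (h : GL (Fin n) F) :
    h ∈ glInt n F ↔ (∀ i j, Valued.v ((h : Matrix (Fin n) (Fin n) F) i j) ≤ 1) ∧ Valued.v (h : Matrix (Fin n) (Fin n) F).det = 1 := by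
  constructor
  · intro hh
    have hdet : Valued.v (h : Matrix (Fin n) (Fin n) F).det = 1 := (v_eq_one_iff_valuation_eq_one _).2 (valuation_det_eq_one_of_mem_glInt hh)
    exact ⟨(mem_glInt_iff_forall_v_le_one_of_v_det_eq_one h hdet).1 hh, hdet⟩
  · rintro ⟨h1, h2⟩
    exact (mem_glInt_iff_forall_v_le_one_of_v_det_eq_one h h2).2 h1

omit [Valued F ℤᵐ⁰] [ValuativeRel F] [(Valued.v : Valuation F ℤᵐ⁰).Compatible] in
/-- `glDiagonal ![1, η]` is the matrix `diag(1, η)`. [cite: Serre1980Trees, Ch. II §1.1] -/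
theorem coe_glDiagonal_one_two (η : Fˣ) : ((glDiagonal 2 F ![1, η] : GL (Fin 2) F) : Matrix (Fin 2) (Fin 2) F) = diagonal ![1, (η : F)] := by
  rw [coe_glDiagonal]
  congr 1
  funext k; fin_cases k <;> simp

omit [Valued F ℤᵐ⁰] [ValuativeRel F] [(Valued.v : Valuation F ℤᵐ⁰).Compatible] in
/-- `(glDiagonal ![1, η])⁻¹` is the matrix `diag(1, η⁻¹)`. [cite: Serre1980Trees, Ch. II §1.1] -/
theorem coe_glDiagonal_one_two_inv (η : Fˣ) : (((glDiagonal 2 F ![1, η])⁻¹ : GL (Fin 2) F) : Matrix (Fin 2) (Fin 2) F) = diagonal ![1, (η : F)⁻¹] := by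
  rw [← map_inv, coe_glDiagonal]
  congr 1
  funext k; fin_cases k <;> simp [Units.val_inv_eq_inv_val]

variable [IsDiscreteValuationRing 𝒪[F]]

/-- **`g · (latt A) = latt B` in the tree of `SL₂(F)` iff `B⁻¹ (ϖ^k g A) ∈ GL₂(𝒪)` for some `k`** (★ `glVertexAct_eq_iff` — `N = ϖ^k · g M` — read through ★
`span_range_transpose_eq_iff`: `latt X = latt Y ↔ X⁻¹Y ∈ GL₂(𝒪)`), with `GL₂(𝒪)`-membership spelled by entries and determinant. [cite: Serre1980Trees, Ch. II §1.1–§1.3] -/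
theorem glVertexAct_eq_iff_exists_forall_v_le_one (g A B : GL (Fin 2) F)
    (M N : {M : Submodule 𝒪[F] (Fin 2 → F) // IsSpecialLattice (RingHom.id F) ϖ !![(0 : F), 1; -1, 0] M})
    (hM : M.1 = latt (A : Matrix (Fin 2) (Fin 2) F)) (hN : N.1 = latt (B : Matrix (Fin 2) (Fin 2) F)) :
    glVertexAct hϖ g M = N ↔ ∃ k : ℤ,
      (∀ i j, Valued.v ((((B⁻¹ : GL (Fin 2) F) : Matrix (Fin 2) (Fin 2) F) * (ϖ ^ k • ((g : Matrix (Fin 2) (Fin 2) F) * (A : Matrix (Fin 2) (Fin 2) F)))) i j) ≤ 1) ∧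
        Valued.v (((B⁻¹ : GL (Fin 2) F) : Matrix (Fin 2) (Fin 2) F) * (ϖ ^ k • ((g : Matrix (Fin 2) (Fin 2) F) * (A : Matrix (Fin 2) (Fin 2) F)))).det = 1 := by
  have hϖ0 : ϖ ≠ 0 := hϖ.ne_zero
  rw [glVertexAct_eq_iff hϖ]
  refine exists_congr fun k => ?_
  -- the homothety `ϖ^k` as an element of `GL₂(F)`
  set c : GL (Fin 2) F := (Units.mk0 (ϖ ^ k) (zpow_ne_zero k hϖ0)).map
    ((Matrix.scalar (Fin 2) : F →+* Matrix (Fin 2) (Fin 2) F) : F →* Matrix (Fin 2) (Fin 2) F) with hc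
  have hcval : (c : Matrix (Fin 2) (Fin 2) F) = ϖ ^ k • (1 : Matrix (Fin 2) (Fin 2) F) := by
    rw [hc, Units.coe_map]; simp [Matrix.scalar_apply, Matrix.smul_one_eq_diagonal]
  have hX : ((c * g * A : GL (Fin 2) F) : Matrix (Fin 2) (Fin 2) F) = ϖ ^ k • ((g : Matrix (Fin 2) (Fin 2) F) * (A : Matrix (Fin 2) (Fin 2) F)) := by
    rw [Units.val_mul, Units.val_mul, hcval, Matrix.smul_mul, Matrix.one_mul, Matrix.smul_mul]
  rw [hM, hN, mapGL_latt_eq, scaleLattice_latt, ← hX, span_range_transpose_eq_iff, mem_glInt_iff_forall_v_le_one_and_v_det_eq_one,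
    Units.val_mul, hX]

/-- **`g · v₀ = v₀ ↔ ∃ k, ϖ^k g ∈ GL₂(𝒪)`** (`v₀ = latt 1 = 𝒪²`). [cite: Serre1980Trees, Ch. II §1.1–§1.3] -/
theorem glVertexAct_root_eq_root_iff (g : GL (Fin 2) F)
    (v₀ : {M : Submodule 𝒪[F] (Fin 2 → F) // IsSpecialLattice (RingHom.id F) ϖ !![(0 : F), 1; -1, 0] M})
    (hv₀ : v₀.1 = latt (1 : Matrix (Fin 2) (Fin 2) F)) :
    glVertexAct hϖ g v₀ = v₀ ↔ ∃ k : ℤ, (∀ i j, Valued.v ((ϖ ^ k • (g : Matrix (Fin 2) (Fin 2) F)) i j) ≤ 1) ∧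
      Valued.v (ϖ ^ k • (g : Matrix (Fin 2) (Fin 2) F)).det = 1 := by
  have h1 : v₀.1 = latt ((1 : GL (Fin 2) F) : Matrix (Fin 2) (Fin 2) F) := by rw [hv₀, Units.val_one]
  rw [glVertexAct_eq_iff_exists_forall_v_le_one hϖ g 1 1 v₀ v₀ h1 h1]
  simp only [inv_one, Units.val_one, Matrix.one_mul, Matrix.mul_one]

/-- **`g · v₁ = v₁ ↔ ∃ k, D⁻¹ (ϖ^k g) D ∈ GL₂(𝒪)`** (`v₁ = latt D`, `D = diag(1, ϖ)`). [cite: Serre1980Trees, Ch. II §1.1–§1.3] -/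
theorem glVertexAct_next_eq_next_iff (g : GL (Fin 2) F)
    (v₁ : {M : Submodule 𝒪[F] (Fin 2 → F) // IsSpecialLattice (RingHom.id F) ϖ !![(0 : F), 1; -1, 0] M})
    (hv₁ : v₁.1 = latt (Matrix.diagonal ![(1 : F), ϖ])) :
    glVertexAct hϖ g v₁ = v₁ ↔ ∃ k : ℤ,
      (∀ i j, Valued.v ((diagonal ![(1 : F), ϖ⁻¹] * (ϖ ^ k • (g : Matrix (Fin 2) (Fin 2) F)) * diagonal ![(1 : F), ϖ]) i j) ≤ 1) ∧
        Valued.v (diagonal ![(1 : F), ϖ⁻¹] * (ϖ ^ k • (g : Matrix (Fin 2) (Fin 2) F)) * diagonal ![(1 : F), ϖ]).det = 1 := by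
  have hϖ0 : ϖ ≠ 0 := hϖ.ne_zero
  have hD : v₁.1 = latt ((glDiagonal 2 F ![1, Units.mk0 ϖ hϖ0] : GL (Fin 2) F) : Matrix (Fin 2) (Fin 2) F) := by
    rw [hv₁, coe_glDiagonal_one_two, Units.val_mk0]
  rw [glVertexAct_eq_iff_exists_forall_v_le_one hϖ g _ _ v₁ v₁ hD hD, coe_glDiagonal_one_two_inv, coe_glDiagonal_one_two, Units.val_mk0]
  simp only [← Matrix.smul_mul, Matrix.mul_assoc]

/-- **`g · v₀ = v₁ ↔ ∃ k, D⁻¹ (ϖ^k g) ∈ GL₂(𝒪)`**. [cite: Serre1980Trees, Ch. II §1.1–§1.3] -/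
theorem glVertexAct_root_eq_next_iff (g : GL (Fin 2) F)
    (v₀ v₁ : {M : Submodule 𝒪[F] (Fin 2 → F) // IsSpecialLattice (RingHom.id F) ϖ !![(0 : F), 1; -1, 0] M})
    (hv₀ : v₀.1 = latt (1 : Matrix (Fin 2) (Fin 2) F)) (hv₁ : v₁.1 = latt (Matrix.diagonal ![(1 : F), ϖ])) :
    glVertexAct hϖ g v₀ = v₁ ↔ ∃ k : ℤ,
      (∀ i j, Valued.v ((diagonal ![(1 : F), ϖ⁻¹] * (ϖ ^ k • (g : Matrix (Fin 2) (Fin 2) F))) i j) ≤ 1) ∧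
        Valued.v (diagonal ![(1 : F), ϖ⁻¹] * (ϖ ^ k • (g : Matrix (Fin 2) (Fin 2) F))).det = 1 := by
  have hϖ0 : ϖ ≠ 0 := hϖ.ne_zero
  have h1 : v₀.1 = latt ((1 : GL (Fin 2) F) : Matrix (Fin 2) (Fin 2) F) := by rw [hv₀, Units.val_one]
  have hD : v₁.1 = latt ((glDiagonal 2 F ![1, Units.mk0 ϖ hϖ0] : GL (Fin 2) F) : Matrix (Fin 2) (Fin 2) F) := by
    rw [hv₁, coe_glDiagonal_one_two, Units.val_mk0]
  rw [glVertexAct_eq_iff_exists_forall_v_le_one hϖ g _ _ v₀ v₁ h1 hD, coe_glDiagonal_one_two_inv, Units.val_mk0, Units.val_one]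
  simp only [Matrix.mul_one]

/-- **`g · v₁ = v₀ ↔ ∃ k, (ϖ^k g) D ∈ GL₂(𝒪)`**. [cite: Serre1980Trees, Ch. II §1.1–§1.3] -/
theorem glVertexAct_next_eq_root_iff (g : GL (Fin 2) F)
    (v₀ v₁ : {M : Submodule 𝒪[F] (Fin 2 → F) // IsSpecialLattice (RingHom.id F) ϖ !![(0 : F), 1; -1, 0] M})
    (hv₀ : v₀.1 = latt (1 : Matrix (Fin 2) (Fin 2) F)) (hv₁ : v₁.1 = latt (Matrix.diagonal ![(1 : F), ϖ])) :
    glVertexAct hϖ g v₁ = v₀ ↔ ∃ k : ℤ,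
      (∀ i j, Valued.v ((ϖ ^ k • (g : Matrix (Fin 2) (Fin 2) F) * diagonal ![(1 : F), ϖ]) i j) ≤ 1) ∧
        Valued.v (ϖ ^ k • (g : Matrix (Fin 2) (Fin 2) F) * diagonal ![(1 : F), ϖ]).det = 1 := by
  have hϖ0 : ϖ ≠ 0 := hϖ.ne_zero
  have h1 : v₀.1 = latt ((1 : GL (Fin 2) F) : Matrix (Fin 2) (Fin 2) F) := by rw [hv₀, Units.val_one]
  have hD : v₁.1 = latt ((glDiagonal 2 F ![1, Units.mk0 ϖ hϖ0] : GL (Fin 2) F) : Matrix (Fin 2) (Fin 2) F) := by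
    rw [hv₁, coe_glDiagonal_one_two, Units.val_mk0]
  rw [glVertexAct_eq_iff_exists_forall_v_le_one hϖ g _ _ v₁ v₀ hD h1, coe_glDiagonal_one_two, Units.val_mk0, inv_one, Units.val_one]
  simp only [Matrix.one_mul, ← Matrix.smul_mul]

/-- **The edge `{v₀, v₁}` is stable under `g` (pointwise or swapped) iff** `(∃k, ϖ^k g ∈ GL₂(𝒪)) ∧ (∃k, D⁻¹ϖ^k g D ∈ GL₂(𝒪))` OR
`(∃k, D⁻¹ ϖ^k g ∈ GL₂(𝒪)) ∧ (∃k, ϖ^k g D ∈ GL₂(𝒪))` — the right-hand side of ★ `forall_v_conj_smul_map_le_one_iff_of_sq` (B). [cite: Serre1980Trees, Ch. II §1.1–§1.3] -/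
theorem sym2_glVertexAct_eq_iff (g : GL (Fin 2) F)
    (v₀ v₁ : {M : Submodule 𝒪[F] (Fin 2 → F) // IsSpecialLattice (RingHom.id F) ϖ !![(0 : F), 1; -1, 0] M})
    (hv₀ : v₀.1 = latt (1 : Matrix (Fin 2) (Fin 2) F)) (hv₁ : v₁.1 = latt (Matrix.diagonal ![(1 : F), ϖ])) :
    s(glVertexAct hϖ g v₀, glVertexAct hϖ g v₁) = s(v₀, v₁) ↔
      ((∃ k : ℤ, (∀ i j, Valued.v ((ϖ ^ k • (g : Matrix (Fin 2) (Fin 2) F)) i j) ≤ 1) ∧ Valued.v (ϖ ^ k • (g : Matrix (Fin 2) (Fin 2) F)).det = 1) ∧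
        (∃ k : ℤ, (∀ i j, Valued.v ((diagonal ![(1 : F), ϖ⁻¹] * (ϖ ^ k • (g : Matrix (Fin 2) (Fin 2) F)) * diagonal ![(1 : F), ϖ]) i j) ≤ 1) ∧
          Valued.v (diagonal ![(1 : F), ϖ⁻¹] * (ϖ ^ k • (g : Matrix (Fin 2) (Fin 2) F)) * diagonal ![(1 : F), ϖ]).det = 1)) ∨
      ((∃ k : ℤ, (∀ i j, Valued.v ((diagonal ![(1 : F), ϖ⁻¹] * (ϖ ^ k • (g : Matrix (Fin 2) (Fin 2) F))) i j) ≤ 1) ∧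
          Valued.v (diagonal ![(1 : F), ϖ⁻¹] * (ϖ ^ k • (g : Matrix (Fin 2) (Fin 2) F))).det = 1) ∧
        (∃ k : ℤ, (∀ i j, Valued.v ((ϖ ^ k • (g : Matrix (Fin 2) (Fin 2) F) * diagonal ![(1 : F), ϖ]) i j) ≤ 1) ∧
          Valued.v (ϖ ^ k • (g : Matrix (Fin 2) (Fin 2) F) * diagonal ![(1 : F), ϖ]).det = 1)) := by
  rw [Sym2.eq_iff, glVertexAct_root_eq_root_iff hϖ g v₀ hv₀, glVertexAct_next_eq_next_iff hϖ g v₁ hv₁, glVertexAct_root_eq_next_iff hϖ g v₀ v₁ hv₀ hv₁,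
    glVertexAct_next_eq_root_iff hϖ g v₀ v₁ hv₀ hv₁]

end Dictionary

end Literature.NumberTheory.Automorphic.HermitianLatticeTree

namespace Literature.NumberTheory.Automorphic.UnitaryGroup

open Literature.NumberTheory.Automorphic Literature.NumberTheory.Automorphic.HermitianLatticeTree

/-! ## §2 At a non-split place `w ∣ v` of a CM field: the levels `K = U_w ∩ GL₂(𝒪_w)` and `K♯ = U_w ∩ D GL₂(𝒪_w) D⁻¹`, `D = diag(1, η)`, as vertex ∕ edge
stabilisers of the tree of `SL₂(L⁺_v)` through the descent `diag(1,α) u diag(1,α)⁻¹ = s · ι_w(g)` -/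

section Place

variable (L : Type) [Field L] [NumberField L] [IsCMField L] {v : HeightOneSpectrum (𝓞 ↥(maximalRealSubfield L))}
  (w : PlacesOver L v) (hw : IsCMField.complexConj L • w.1 = w.1)

/-- An element of `U_w = U(σ_w, (Φ₂)_w)` lies in `U(σ_w, !![0,1;1,0])` (★ `placeForm_antidiagTwo_eq`). [cite: Rogawski1990, §3.6 p. 31] -/
theorem coe_mem_unitaryGroupOfForm_antidiag_two_of_mem_placeForm
    (u : ↥(unitaryGroupOfForm (galAdicCompletionMap (L := L) (IsCMField.complexConj L) hw)
      (placeForm (Matrix.of fun i j : Fin 2 => if i.val + j.val + 1 = 2 then (1 : L) else 0) w.1))) :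
    (u : GL (Fin 2) (w.1.adicCompletion L)) ∈ unitaryGroupOfForm (galAdicCompletionMap (L := L) (IsCMField.complexConj L) hw)
      !![(0 : w.1.adicCompletion L), 1; 1, 0] := by
  obtain ⟨u', hu'⟩ := u
  rw [placeForm_antidiagTwo_eq L v w] at hu'
  exact hu'

/-- `|det u|_w = 1` on `U_w`. [cite: Rogawski1990, §3.6 p. 31] -/
theorem v_det_coe_eq_one_of_mem_placeForm
    (u : ↥(unitaryGroupOfForm (galAdicCompletionMap (L := L) (IsCMField.complexConj L) hw)
      (placeForm (Matrix.of fun i j : Fin 2 => if i.val + j.val + 1 = 2 then (1 : L) else 0) w.1))) :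
    Valued.v ((u : GL (Fin 2) (w.1.adicCompletion L)) : Matrix (Fin 2) (Fin 2) (w.1.adicCompletion L)).det = 1 :=
  v_det_eq_one_of_mem_unitaryGroupOfForm_antidiag_two _ (fun x => valued_galAdicCompletionMap L (IsCMField.complexConj L) hw x)
    (coe_mem_unitaryGroupOfForm_antidiag_two_of_mem_placeForm L w hw u)

/-- **`K`-membership by entries**: `u ∈ GL₂(𝒪_w) ↔` all entries of `u` are `w`-integral (`|det u| = 1`). [cite: Serre1980Trees, Ch. II §1.1] -/
theorem coe_mem_glInt_iff_forall_v_le_one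
    (u : ↥(unitaryGroupOfForm (galAdicCompletionMap (L := L) (IsCMField.complexConj L) hw)
      (placeForm (Matrix.of fun i j : Fin 2 => if i.val + j.val + 1 = 2 then (1 : L) else 0) w.1))) :
    (u : GL (Fin 2) (w.1.adicCompletion L)) ∈ glInt 2 (w.1.adicCompletion L) ↔
      ∀ i j, Valued.v (((u : GL (Fin 2) (w.1.adicCompletion L)) : Matrix (Fin 2) (Fin 2) (w.1.adicCompletion L)) i j) ≤ 1 :=
  mem_glInt_iff_forall_v_le_one_of_v_det_eq_one _ (v_det_coe_eq_one_of_mem_placeForm L w hw u)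

/-- **`K♯_D`-membership by entries**, `D = glDiagonal ![1, η]`: `u ∈ D GL₂(𝒪_w) D⁻¹ ↔` all entries of `diag(1,η)⁻¹ u diag(1,η)` are `w`-integral.
[cite: Serre1980Trees, Ch. II §1.1] [cite: Kottwitz1988, §2] -/
theorem coe_mem_map_conj_glDiagonal_iff_forall_v_le_one (η : (w.1.adicCompletion L)ˣ)
    (u : ↥(unitaryGroupOfForm (galAdicCompletionMap (L := L) (IsCMField.complexConj L) hw)
      (placeForm (Matrix.of fun i j : Fin 2 => if i.val + j.val + 1 = 2 then (1 : L) else 0) w.1))) :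
    (u : GL (Fin 2) (w.1.adicCompletion L)) ∈
        (glInt 2 (w.1.adicCompletion L)).map (MulAut.conj (glDiagonal 2 (w.1.adicCompletion L) ![1, η])).toMonoidHom ↔
      ∀ i j, Valued.v ((diagonal ![(1 : w.1.adicCompletion L), (η : w.1.adicCompletion L)⁻¹] *
        ((u : GL (Fin 2) (w.1.adicCompletion L)) : Matrix (Fin 2) (Fin 2) (w.1.adicCompletion L)) *
          diagonal ![(1 : w.1.adicCompletion L), (η : w.1.adicCompletion L)]) i j) ≤ 1 := by
  rw [Subgroup.mem_map_equiv, MulAut.conj_symm_apply]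
  have hdet : Valued.v (((glDiagonal 2 (w.1.adicCompletion L) ![1, η])⁻¹ * (u : GL (Fin 2) (w.1.adicCompletion L)) *
      glDiagonal 2 (w.1.adicCompletion L) ![1, η] : GL (Fin 2) (w.1.adicCompletion L)) : Matrix (Fin 2) (Fin 2) (w.1.adicCompletion L)).det = 1 := by
    rw [Units.val_mul, Units.val_mul, Matrix.det_units_conj']
    exact v_det_coe_eq_one_of_mem_placeForm L w hw u
  rw [mem_glInt_iff_forall_v_le_one_of_v_det_eq_one _ hdet, Units.val_mul, Units.val_mul, coe_glDiagonal_one_two_inv, coe_glDiagonal_one_two]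

variable [IsDiscreteValuationRing 𝒪[v.adicCompletion ↥(maximalRealSubfield L)]]
  {ϖ : v.adicCompletion ↥(maximalRealSubfield L)} (hϖ : IsUniformizingElement ϖ) (hϖv : Valued.v ϖ = exp (-1 : ℤ))
  (v₀ v₁ : {M : Submodule 𝒪[v.adicCompletion ↥(maximalRealSubfield L)] (Fin 2 → v.adicCompletion ↥(maximalRealSubfield L)) //
      IsSpecialLattice (RingHom.id (v.adicCompletion ↥(maximalRealSubfield L))) ϖ !![(0 : v.adicCompletion ↥(maximalRealSubfield L)), 1; -1, 0] M})
  (hv₀ : v₀.1 = latt (1 : Matrix (Fin 2) (Fin 2) (v.adicCompletion ↥(maximalRealSubfield L))))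
  (hv₁ : v₁.1 = latt (Matrix.diagonal ![(1 : v.adicCompletion ↥(maximalRealSubfield L)), ϖ]))

include hϖv hv₀ in
/-- **`√u`-TYPE VERTEX: `K = Stab(v₀)`.**  If `α ∈ L_w` is an anti-fixed UNIT (`σ_w α = −α`, `|α|_w = 1`; exists exactly when `L_w = L⁺_v(√u)` with `u` a unit —
the inert places and the wild ramified places of that type) and `diag(1,α) u diag(1,α)⁻¹ = s · ι_w(g)` (★ `exists_conj_diagonal_eq_smul_map_toPlace`), then
`u ∈ GL₂(𝒪_w) ↔ g · v₀ = v₀` (`v₀ = 𝒪_v²` the standard vertex of the tree of `SL₂(L⁺_v)`). [cite: Tits1979, §2.7 and §3.9] [cite: Serre1980Trees, Ch. II §1.3] -/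
theorem coe_mem_glInt_iff_glVertexAct_root_eq_of_v_eq_one {α : w.1.adicCompletion L} (hvα : Valued.v α = 1)
    (u : ↥(unitaryGroupOfForm (galAdicCompletionMap (L := L) (IsCMField.complexConj L) hw)
      (placeForm (Matrix.of fun i j : Fin 2 => if i.val + j.val + 1 = 2 then (1 : L) else 0) w.1)))
    {s : w.1.adicCompletion L} {g : GL (Fin 2) (v.adicCompletion ↥(maximalRealSubfield L))}
    (hsg : diagonal ![1, α] * ((u : GL (Fin 2) (w.1.adicCompletion L)) : Matrix (Fin 2) (Fin 2) (w.1.adicCompletion L)) * diagonal ![1, α⁻¹] =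
      s • ((g : Matrix (Fin 2) (Fin 2) (v.adicCompletion ↥(maximalRealSubfield L))).map (toPlace v w))) :
    (u : GL (Fin 2) (w.1.adicCompletion L)) ∈ glInt 2 (w.1.adicCompletion L) ↔ glVertexAct hϖ g v₀ = v₀ := by
  have hα0 : α ≠ 0 := fun h => by rw [h, map_zero] at hvα; exact zero_ne_one hvα
  have hdet : Valued.v (s • ((g : Matrix (Fin 2) (Fin 2) (v.adicCompletion ↥(maximalRealSubfield L))).map (toPlace v w))).det = 1 := by
    rw [← hsg]
    exact v_det_conj_diagonal_eq_one_of_mem_unitaryGroupOfForm_antidiag_two _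
      (fun x => valued_galAdicCompletionMap L (IsCMField.complexConj L) hw x) (coe_mem_unitaryGroupOfForm_antidiag_two_of_mem_placeForm L w hw u) hα0
  have hu : ((u : GL (Fin 2) (w.1.adicCompletion L)) : Matrix (Fin 2) (Fin 2) (w.1.adicCompletion L)) =
      diagonal ![1, α⁻¹] * (s • ((g : Matrix (Fin 2) (Fin 2) (v.adicCompletion ↥(maximalRealSubfield L))).map (toPlace v w))) * diagonal ![1, α] := by
    rw [← hsg, diagonal_inv_mul_conj_diagonal_mul_diagonal hα0]
  rw [coe_mem_glInt_iff_forall_v_le_one L w hw u, hu, forall_v_conj_diagonal_le_one_iff_of_v_eq_one hvα,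
    forall_v_smul_map_le_one_iff_exists_zpow_smul (toPlace v w) (valued_toPlace v w) (ramificationIdx'_placesOver_ne_zero w) hϖv hdet,
    glVertexAct_root_eq_root_iff hϖ g v₀ hv₀]

include hϖv hv₀ hv₁ in
/-- **`√u`-TYPE EDGE (ramified `w`): `K♯_{diag(1,η)} = Stab{v₀, v₁}`** for any uniformiser `η` of `L_w`: with `α` an anti-fixed unit as above,
`u ∈ diag(1,η) GL₂(𝒪_w) diag(1,η)⁻¹ ↔ s(g·v₀, g·v₁) = s(v₀, v₁)` (`v₁ = 𝒪_v ⊕ ϖ_v 𝒪_v`; the edge may be inverted). [cite: Tits1979, §2.7 and §3.9]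
[cite: Serre1980Trees, Ch. II §1.3] [cite: Kottwitz1988, §2] -/
theorem coe_mem_map_conj_glDiagonal_iff_sym2_glVertexAct_eq_of_v_eq_one (he : v.asIdeal.ramificationIdx' w.1.asIdeal ≠ 1)
    {α : w.1.adicCompletion L} (hvα : Valued.v α = 1) (η : (w.1.adicCompletion L)ˣ) (hη : Valued.v (η : w.1.adicCompletion L) = exp (-1 : ℤ))
    (u : ↥(unitaryGroupOfForm (galAdicCompletionMap (L := L) (IsCMField.complexConj L) hw)
      (placeForm (Matrix.of fun i j : Fin 2 => if i.val + j.val + 1 = 2 then (1 : L) else 0) w.1)))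
    {s : w.1.adicCompletion L} {g : GL (Fin 2) (v.adicCompletion ↥(maximalRealSubfield L))}
    (hsg : diagonal ![1, α] * ((u : GL (Fin 2) (w.1.adicCompletion L)) : Matrix (Fin 2) (Fin 2) (w.1.adicCompletion L)) * diagonal ![1, α⁻¹] =
      s • ((g : Matrix (Fin 2) (Fin 2) (v.adicCompletion ↥(maximalRealSubfield L))).map (toPlace v w))) :
    (u : GL (Fin 2) (w.1.adicCompletion L)) ∈
        (glInt 2 (w.1.adicCompletion L)).map (MulAut.conj (glDiagonal 2 (w.1.adicCompletion L) ![1, η])).toMonoidHom ↔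
      s(glVertexAct hϖ g v₀, glVertexAct hϖ g v₁) = s(v₀, v₁) := by
  have hα0 : α ≠ 0 := fun h => by rw [h, map_zero] at hvα; exact zero_ne_one hvα
  have hdet : Valued.v (s • ((g : Matrix (Fin 2) (Fin 2) (v.adicCompletion ↥(maximalRealSubfield L))).map (toPlace v w))).det = 1 := by
    rw [← hsg]
    exact v_det_conj_diagonal_eq_one_of_mem_unitaryGroupOfForm_antidiag_two _
      (fun x => valued_galAdicCompletionMap L (IsCMField.complexConj L) hw x) (coe_mem_unitaryGroupOfForm_antidiag_two_of_mem_placeForm L w hw u) hα0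
  have hu : ((u : GL (Fin 2) (w.1.adicCompletion L)) : Matrix (Fin 2) (Fin 2) (w.1.adicCompletion L)) =
      diagonal ![1, α⁻¹] * (s • ((g : Matrix (Fin 2) (Fin 2) (v.adicCompletion ↥(maximalRealSubfield L))).map (toPlace v w))) * diagonal ![1, α] := by
    rw [← hsg, diagonal_inv_mul_conj_diagonal_mul_diagonal hα0]
  have hπ : Valued.v (α * (η : w.1.adicCompletion L)) = exp (-1 : ℤ) := by rw [map_mul, hvα, hη, one_mul]
  rw [coe_mem_map_conj_glDiagonal_iff_forall_v_le_one L w hw η u, hu, diagonal_inv_mul_conj_diagonal_inv_mul_diagonal,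
    forall_v_conj_smul_map_le_one_iff_of_sq (toPlace v w)
      (valued_toPlace_eq_pow_two_of_ramified (IsCMField.complexConj L) w (IsCMField.complexConj_ne_one L) hw he) hπ hϖv hdet,
    sym2_glVertexAct_eq_iff hϖ g v₀ v₁ hv₀ hv₁]

include hϖv hv₁ in
/-- **`√π`-TYPE VERTEX (ramified `w`): `K♯_{diag(1,η)} = Stab(v₁)`.**  If `α` is an anti-fixed UNIFORMISER (`σ_w α = −α`, `|α|_w = exp(−1)`: every tamely ramified
place, ★ `RamifiedPlaceAntiFixedUniformizer`, and the wild ones of type `L⁺_v(√π)`) and `diag(1,α) u diag(1,α)⁻¹ = s · ι_w(g)`, then for any uniformiser `η`: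
`u ∈ diag(1,η) GL₂(𝒪_w) diag(1,η)⁻¹ ↔ g · v₁ = v₁`. [cite: Tits1979, §2.7 and §3.9] [cite: Serre1980Trees, Ch. II §1.3] [cite: Kottwitz1988, §2] -/
theorem coe_mem_map_conj_glDiagonal_iff_glVertexAct_next_eq_of_v_eq_exp_neg_one (he : v.asIdeal.ramificationIdx' w.1.asIdeal ≠ 1)
    {α : w.1.adicCompletion L} (hvα : Valued.v α = exp (-1 : ℤ)) (η : (w.1.adicCompletion L)ˣ)
    (hη : Valued.v (η : w.1.adicCompletion L) = exp (-1 : ℤ))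
    (u : ↥(unitaryGroupOfForm (galAdicCompletionMap (L := L) (IsCMField.complexConj L) hw)
      (placeForm (Matrix.of fun i j : Fin 2 => if i.val + j.val + 1 = 2 then (1 : L) else 0) w.1)))
    {s : w.1.adicCompletion L} {g : GL (Fin 2) (v.adicCompletion ↥(maximalRealSubfield L))}
    (hsg : diagonal ![1, α] * ((u : GL (Fin 2) (w.1.adicCompletion L)) : Matrix (Fin 2) (Fin 2) (w.1.adicCompletion L)) * diagonal ![1, α⁻¹] =
      s • ((g : Matrix (Fin 2) (Fin 2) (v.adicCompletion ↥(maximalRealSubfield L))).map (toPlace v w))) :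
    (u : GL (Fin 2) (w.1.adicCompletion L)) ∈
        (glInt 2 (w.1.adicCompletion L)).map (MulAut.conj (glDiagonal 2 (w.1.adicCompletion L) ![1, η])).toMonoidHom ↔
      glVertexAct hϖ g v₁ = v₁ := by
  have hα0 : α ≠ 0 := fun h => by rw [h, map_zero] at hvα; exact exp_ne_zero hvα.symm
  have hdet : Valued.v (s • ((g : Matrix (Fin 2) (Fin 2) (v.adicCompletion ↥(maximalRealSubfield L))).map (toPlace v w))).det = 1 := by
    rw [← hsg]
    exact v_det_conj_diagonal_eq_one_of_mem_unitaryGroupOfForm_antidiag_two _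
      (fun x => valued_galAdicCompletionMap L (IsCMField.complexConj L) hw x) (coe_mem_unitaryGroupOfForm_antidiag_two_of_mem_placeForm L w hw u) hα0
  have hu : ((u : GL (Fin 2) (w.1.adicCompletion L)) : Matrix (Fin 2) (Fin 2) (w.1.adicCompletion L)) =
      diagonal ![1, α⁻¹] * (s • ((g : Matrix (Fin 2) (Fin 2) (v.adicCompletion ↥(maximalRealSubfield L))).map (toPlace v w))) * diagonal ![1, α] := by
    rw [← hsg, diagonal_inv_mul_conj_diagonal_mul_diagonal hα0]
  have hι2 := valued_toPlace_eq_pow_two_of_ramified (IsCMField.complexConj L) w (IsCMField.complexConj_ne_one L) hw he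
  have hαη : Valued.v (α * (η : w.1.adicCompletion L)) = Valued.v (toPlace v w ϖ) := by
    rw [map_mul, hvα, hη, hι2, hϖv, pow_two]
  rw [coe_mem_map_conj_glDiagonal_iff_forall_v_le_one L w hw η u, hu, diagonal_inv_mul_conj_diagonal_inv_mul_diagonal,
    forall_v_conj_diagonal_le_one_iff_of_v_eq hαη,
    forall_v_conj_map_smul_map_le_one_iff_exists_zpow_smul (toPlace v w) (valued_toPlace v w) (ramificationIdx'_placesOver_ne_zero w) hϖv hdet,
    glVertexAct_next_eq_next_iff hϖ g v₁ hv₁]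

include hϖv hv₀ hv₁ in
/-- **`√π`-TYPE EDGE (ramified `w`): `K = Stab{v₁, v₀}`** (with the inversion `Φ₂ ∈ K`): for `α` an anti-fixed uniformiser and `diag(1,α) u diag(1,α)⁻¹ = s · ι_w(g)`,
`u ∈ GL₂(𝒪_w) ↔ s(g·v₁, g·v₀) = s(v₁, v₀)`. [cite: Tits1979, §2.7 and §3.9] [cite: Serre1980Trees, Ch. II §1.3] [cite: Kottwitz1988, §2] -/
theorem coe_mem_glInt_iff_sym2_glVertexAct_eq_of_v_eq_exp_neg_one (he : v.asIdeal.ramificationIdx' w.1.asIdeal ≠ 1)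
    {α : w.1.adicCompletion L} (hvα : Valued.v α = exp (-1 : ℤ))
    (u : ↥(unitaryGroupOfForm (galAdicCompletionMap (L := L) (IsCMField.complexConj L) hw)
      (placeForm (Matrix.of fun i j : Fin 2 => if i.val + j.val + 1 = 2 then (1 : L) else 0) w.1)))
    {s : w.1.adicCompletion L} {g : GL (Fin 2) (v.adicCompletion ↥(maximalRealSubfield L))}
    (hsg : diagonal ![1, α] * ((u : GL (Fin 2) (w.1.adicCompletion L)) : Matrix (Fin 2) (Fin 2) (w.1.adicCompletion L)) * diagonal ![1, α⁻¹] =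
      s • ((g : Matrix (Fin 2) (Fin 2) (v.adicCompletion ↥(maximalRealSubfield L))).map (toPlace v w))) :
    (u : GL (Fin 2) (w.1.adicCompletion L)) ∈ glInt 2 (w.1.adicCompletion L) ↔
      s(glVertexAct hϖ g v₁, glVertexAct hϖ g v₀) = s(v₁, v₀) := by
  have hα0 : α ≠ 0 := fun h => by rw [h, map_zero] at hvα; exact exp_ne_zero hvα.symm
  have hdet : Valued.v (s • ((g : Matrix (Fin 2) (Fin 2) (v.adicCompletion ↥(maximalRealSubfield L))).map (toPlace v w))).det = 1 := by
    rw [← hsg]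
    exact v_det_conj_diagonal_eq_one_of_mem_unitaryGroupOfForm_antidiag_two _
      (fun x => valued_galAdicCompletionMap L (IsCMField.complexConj L) hw x) (coe_mem_unitaryGroupOfForm_antidiag_two_of_mem_placeForm L w hw u) hα0
  have hu : ((u : GL (Fin 2) (w.1.adicCompletion L)) : Matrix (Fin 2) (Fin 2) (w.1.adicCompletion L)) =
      diagonal ![1, α⁻¹] * (s • ((g : Matrix (Fin 2) (Fin 2) (v.adicCompletion ↥(maximalRealSubfield L))).map (toPlace v w))) * diagonal ![1, α] := by
    rw [← hsg, diagonal_inv_mul_conj_diagonal_mul_diagonal hα0]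
  rw [Sym2.eq_swap (a := glVertexAct hϖ g v₁), Sym2.eq_swap (a := v₁), coe_mem_glInt_iff_forall_v_le_one L w hw u, hu,
    forall_v_conj_smul_map_le_one_iff_of_sq (toPlace v w)
      (valued_toPlace_eq_pow_two_of_ramified (IsCMField.complexConj L) w (IsCMField.complexConj_ne_one L) hw he) hvα hϖv hdet,
    sym2_glVertexAct_eq_iff hϖ g v₀ v₁ hv₀ hv₁]

end Place

end Literature.NumberTheory.Automorphic.UnitaryGroup
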